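/-
Copyright (c) 2026. All rights reserved.
Released under Apache 2.0 license as described in the file LICENSE.
Authors: abc-iut cell, seat abc-iut-L4-t9 (gen 4; block W2-B2, [AbsTopIII] Cor 3.7 at the slim sub-model).
-/
import Literature.AnabelianGeometry.AbsoluteAnabelian.AbsTopIII.BiAnabelianModelProofs
import Literature.AnabelianGeometry.AbsoluteAnabelian.AbsTopIII.MLFGaloisModelIdRigid
import Literature.AnabelianGeometry.AbsoluteAnabelian.AbsTopIII.BiAnabelianRestriction
import Literature.AnabelianGeometry.AbsoluteAnabelian.AbsTopIII.BiAnabelianAssembly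
import HarnessLib

/-!
# [AbsTopIII] Corollary 3.7 (i)–(v) at the MODEL restricted as printed (`𝒳` on slim `Π_k`),
# modulo the bi-anabelian lift datum `θ^bi` of Cor 1.10 ONLY

S. Mochizuki, *Topics in absolute anabelian geometry III* [MochizukiAbsTopIII2015] (kurims manuscript
`paper:url-5493eb38cbb7`), Cor 3.7 pp. 86–89, stated for `𝒳 = 𝒞^{MLF-sB}_{T𝔽}` ("MLF-Galois `T𝔽`-pairs
of strictly Belyi type", Galois-isomorphisms; Def 3.1 (iii) p. 68: a FULL SUBCATEGORY of `𝒞^{MLF}_{T𝔽}`).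

PROOF-ONLY assembly (abc-iut cell, seat abc-iut-L4-t9 gen 4).  Inputs, all BY NAME:
* gen 3's MODEL `TFModel.modelSetting p` of the Cor 3.7 input structure on the category `TFModel p` of
  ALL model `TF`-pairs `(Π_k ↷ ℚ̄_p)` (`MLFLogFrobeniusFunctors.lean`) and its Lemma-3.4 separation
  `iotaLogMap_ne_timesToPf_prime` / mono-analytic object `TFModel.monoAnalytic` (`BiAnabelianModelProofs`);
* gen 4's restriction device `BiAnabelianSetting.restrict` (`BiAnabelianRestriction.lean`) and
  id-rigidity `TFModel.isIdRigid_slim` of the full subcategory `TFModel.Slim p` on slim `Π_k`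
  (`MLFGaloisModelIdRigid.lean`; print: `Π` of hyperbolic orbicurve / strictly Belyi type is slim,
  [AbsTopI] Prop 2.3 (ii));
* abc-iut-w5-d210's assembly `BiAnabelianSetting.cor_3_7_of_inputs θ hobs hX` (`BiAnabelianAssembly`).

Results: `TFModel.modelSettingSlim p` (the model setting restricted to slim `Π_k`);
`modelSettingSlim_logKernelObstruction` (Lemma 3.4 at the slim mono-analytic object `(G_{ℚ_p} ↷ ℚ̄_p)`);
`model_slim_incompatibleStmt` (Cor 3.7 (iv) first incompatibility, unconditional);
`model_slim_cor_3_7_v θ` — **Cor 3.7 (v) at the slim sub-model modulo `θ^bi` only** (the `hX` input is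
DISCHARGED by `isIdRigid_slim`); `model_slim_cor_3_7 θ` — (i)–(v) together modulo `θ^bi` only.

HONEST FRAMING: `θ^bi` ("arises from the functoriality [...] of the 'group-theoretic' algorithms of
Corollary 1.10", p. 87) is Mochizuki's relative Grothendieck-conjecture input for strictly-Belyi-type
curves and is NOT constructed in the tree (campaign-L base); every statement below is "for every `θ`".
Residue-characteristic-`p` component on the fixed closure `ℚ̄_p`; discrete topologies on `TS`-data;
`log_{TF,TF} = 𝟭` in log-coordinates.  Nothing here bears on [IUTchIII] Cor. 3.12; typed ≠ discharged.
-/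

set_option autoImplicit false

noncomputable section

namespace Literature.AnabelianGeometry.AbsoluteAnabelian.AbsTopIII

open CategoryTheory
open Literature.AlgebraicGeometry.Frobenioids (IsSlimGroup)

namespace TFModel

variable (p : ℕ) [hp : Fact p.Prime]

/-- **The model setting restricted as printed**: gen 3's `modelSetting p` on ALL model `TF`-pairs,
restricted (gen 4's `BiAnabelianSetting.restrict`) to the full subcategory `TFModel.Slim p` of pairs
`(Π_k ↷ ℚ̄_p)` with slim `Π_k` (`log = 𝟭` preserves every object property).
[cite: MochizukiAbsTopIII2015, Cor 3.7 p.86] -/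
def modelSettingSlim : BiAnabelianSetting (Slim p) TopGroupObj TSObj :=
  (modelSetting p).restrict (fun A : TFModel p => IsSlimGroup A.pair.Pi) fun _ h => h

/-- The mono-analytic model objects `(G_k ↷ ℚ̄_p)` have slim `Π_k = G_k` (`isSlimGroup_galk`), so lie
in the slim sub-model. [cite: MochizukiAbsTopIII2015, Definition 3.1 (ii) p.67] -/
theorem isSlimGroup_monoAnalytic_Pi (k : IntermediateField ℚ_[p] (PadicAlgCl p))
    [FiniteDimensional ℚ_[p] k] : IsSlimGroup (monoAnalytic p k).pair.Pi :=
  isSlimGroup_galk (monoAnalytic p k)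

/-- The mono-analytic object over `ℚ_p` as an object of the slim sub-model.
[cite: MochizukiAbsTopIII2015, Definition 3.1 (ii) p.67] -/
def monoAnalyticSlim : Slim p := ⟨monoAnalytic p ⊥, isSlimGroup_monoAnalytic_Pi p ⊥⟩

/-- **Lemma 3.4 at the slim sub-model**: the `LogKernelObstruction` of the restricted setting, witnessed
at `(G_{ℚ_p} ↷ ℚ̄_p)` — for EVERY morphism `a` there, `(λ^×(a) ≫ ι_log)(p) ∈ (𝒪^×_k̄)^pf ∌ [p] = ι_×(p)`
(gen 3's `iotaLogMap_ne_timesToPf_prime`). [cite: MochizukiAbsTopIII2015, Lemma 3.4 p.74] -/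
theorem modelSettingSlim_logKernelObstruction :
    Literature.AnabelianGeometry.AbsoluteAnabelian.AbsTopIII.BiAnabelianSetting.LogKernelObstruction
      (modelSettingSlim p) := by
  refine (modelSetting p).logKernelObstruction_restrict _ _ (monoAnalytic p ⊥)
    (isSlimGroup_monoAnalytic_Pi p ⊥) fun a _ h => ?_
  have h1 : ((modelSetting p).lamTimes.map a ≫ (modelSetting p).iotaLog.app (monoAnalytic p ⊥)).homM
      (primeTimes p) = ((modelSetting p).iotaTimes.app (monoAnalytic p ⊥)).homM (primeTimes p) := by
    rw [h]
  exact iotaLogMap_ne_timesToPf_prime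
    (unitsGal (Hom.galois (a : Hom (monoAnalytic p ⊥) (monoAnalytic p ⊥))) (primeTimes p)) h1

/-- **Cor 3.7 (iv), first incompatibility, at the slim sub-model** (unconditional).
[cite: MochizukiAbsTopIII2015, Cor 3.7 (iv) p.88] -/
theorem model_slim_incompatibleStmt :
    Literature.AnabelianGeometry.AbsoluteAnabelian.AbsTopIII.BiAnabelianSetting.IncompatibleStmt
      (modelSettingSlim p) :=
  (modelSettingSlim p).incompatibleStmt_of_obstruction (modelSettingSlim_logKernelObstruction p)

/-- **Cor 3.7 (v) at the slim sub-model, modulo the lift datum `θ^bi` ONLY**: "`𝒟*` admits a natural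
structure of `ℤ`-diagram [...] `𝒟*` is totally `□`-rigid [...] natural action of `ℤ` on `𝒟*` by
nexus-classes of self-equivalences" — abc-iut-L4-t12's `cor_3_7_v_of_lift θ hX` with `hX` DISCHARGED
by `isIdRigid_slim` (Prop 3.2 (iv) at the model). [cite: MochizukiAbsTopIII2015, Cor 3.7 (v) p.88] -/
theorem model_slim_cor_3_7_v (θ : FiberSquare.BiAnabelianLift (modelSettingSlim p).gal) :
    Literature.AnabelianGeometry.AbsoluteAnabelian.AbsTopIII.BiAnabelianSetting.Cor_3_7_v
      (modelSettingSlim p) :=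
  (modelSettingSlim p).cor_3_7_v_of_lift θ (isIdRigid_slim p)

/-- **[AbsTopIII] Cor 3.7 (i)–(v) at the slim sub-model, modulo `θ^bi` ONLY** (w5-d210's
`cor_3_7_of_inputs` with `hobs := modelSettingSlim_logKernelObstruction` and `hX := isIdRigid_slim`).
[cite: MochizukiAbsTopIII2015, Cor 3.7 pp.86–89] -/
theorem model_slim_cor_3_7 (θ : FiberSquare.BiAnabelianLift (modelSettingSlim p).gal) :
    (modelSettingSlim p).Cor_3_7_i ∧ (modelSettingSlim p).Cor_3_7_ii θ ∧
      Literature.AnabelianGeometry.AbsoluteAnabelian.AbsTopIII.BiAnabelianSetting.Cor_3_7_iii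
        (modelSettingSlim p) ∧
      (modelSettingSlim p).Cor_3_7_iv θ ∧ (modelSettingSlim p).Cor_3_7_v :=
  (modelSettingSlim p).cor_3_7_of_inputs θ (modelSettingSlim_logKernelObstruction p) (isIdRigid_slim p)

/-- The same for a lift datum `θ^bi` given on the WHOLE model `𝒳 = TFModel p` (restricted to the slim
sub-model by `FiberSquare.BiAnabelianLift.restrict`). [cite: MochizukiAbsTopIII2015, Cor 3.7 pp.86–89] -/
theorem model_slim_cor_3_7_of_lift (θ : FiberSquare.BiAnabelianLift (modelSetting p).gal) :
    (modelSettingSlim p).Cor_3_7_i ∧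
      (modelSettingSlim p).Cor_3_7_ii (θ.restrict fun A : TFModel p => IsSlimGroup A.pair.Pi) ∧
      Literature.AnabelianGeometry.AbsoluteAnabelian.AbsTopIII.BiAnabelianSetting.Cor_3_7_iii
        (modelSettingSlim p) ∧
      (modelSettingSlim p).Cor_3_7_iv (θ.restrict fun A : TFModel p => IsSlimGroup A.pair.Pi) ∧
      (modelSettingSlim p).Cor_3_7_v :=
  model_slim_cor_3_7 p _

end TFModel

end Literature.AnabelianGeometry.AbsoluteAnabelian.AbsTopIII

end
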